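import Summits.AnomalousDissipation.AnomalousDissipation.Theorems.SolenoidalFractalHomogenisationLagrangianStepLossCurrency

/-!
# K1L_D (stmt-AnomalousDissipation-27980), (V_mod) loss currency — COMPARABILITY of the cell member's losses with the coarse member's
# (amendment of `…LagrangianStepLossCurrency` p690895; planner ad-ideate-p5 g14's critique of L10 §2(a), item (a-iii); ruling D26-13 F3)

Port note (prover ad-k1loc-p3 g8, `--supports 27980 --as helper`): planner ad-ideate-p5 g14's crux workfile `Lines/onelevel_loss_comparability.lean`
(sha12 3dda7c7638b1, rc 0) VERBATIM modulo the namespace (now `…LagrangianStep.LossCurrency`, the landed file's).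

Generic real Hilbert space, inline losses, same conventions as `…LagrangianStepLossCurrency` (p690895).

If the pair `(U, T)` satisfies the loss-currency bound with BOTH losses on the coarse member `T`,
`|⟪(U − T)x, ζ⟫| ≤ η·√q_T(x)·√q*_T(ζ)` (`q_T(x) = ‖x‖² − ‖Tx‖²`, `q*_T(ζ) = ‖ζ‖² − ‖T†ζ‖²`), and `T` is a contraction, then the forward
loss of the CELL member is comparable to that of `T`:  **`q_U(x) ≤ (1 + 2η)·q_T(x)`** (`loss_le_of_lossBound`), and dually
**`q*_U(ζ) ≤ (1 + 2η)·q*_T(ζ)`** (`lossAdj_le_of_lossBound`).  Key step (`lossAdj_apply_le_loss`, no self-adjointness needed):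
`q*_T(Tx) ≤ q_T(x)`, from `‖Tx‖² = ⟪T†Tx, x⟫ ≤ ‖T†Tx‖·‖x‖`.

Use: the Duhamel/energy estimate naturally produces the MIXED form `η_D·√q_U(x)·√q*_T(ζ)`; these lemmas show the T-form and the mixed
form are equivalent up to `(1+2η)`, so a continuity/bootstrap argument in the window length can convert one into the other.  No sorry.
Not a proof of any registered stub; algebra only.
-/

set_option linter.dupNamespace false  -- the summit-side namespace repeats `AnomalousDissipation` by design (D-0017)

noncomputable section

namespace Summit.AnomalousDissipation.AnomalousDissipation.Theorems.SolenoidalFractalHomogenisation.LagrangianStep.LossCurrency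

open scoped InnerProductSpace

variable {H : Type*} [NormedAddCommGroup H] [InnerProductSpace ℝ H] [CompleteSpace H]

/-- `q*_T(Tx) ≤ q_T(x)` for a contraction `T` (no self-adjointness): `‖Tx‖² − ‖T†(Tx)‖² ≤ ‖x‖² − ‖Tx‖²`. -/
theorem lossAdj_apply_le_loss {T : H →L[ℝ] H} (hT : ∀ y, ‖T y‖ ≤ ‖y‖) (x : H) :
    ‖T x‖ ^ 2 - ‖ContinuousLinearMap.adjoint T (T x)‖ ^ 2 ≤ ‖x‖ ^ 2 - ‖T x‖ ^ 2 := by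
  by_cases hx : x = 0
  · subst hx; simp
  have hn : 0 < ‖x‖ := norm_pos_iff.mpr hx
  -- ‖Tx‖² = ⟪T†(Tx), x⟫ ≤ ‖T†(Tx)‖‖x‖
  have h1 : ‖T x‖ ^ 2 ≤ ‖ContinuousLinearMap.adjoint T (T x)‖ * ‖x‖ := by
    have e : ‖T x‖ ^ 2 = ⟪ContinuousLinearMap.adjoint T (T x), x⟫_ℝ := by
      rw [ContinuousLinearMap.adjoint_inner_left, real_inner_self_eq_norm_sq]
    rw [e]
    exact (le_abs_self _).trans (abs_real_inner_le_norm _ _)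
  have hTx : ‖T x‖ ≤ ‖x‖ := hT x
  have ha : 0 ≤ ‖ContinuousLinearMap.adjoint T (T x)‖ := norm_nonneg _
  have ht : 0 ≤ ‖T x‖ := norm_nonneg _
  -- (‖Tx‖²)² ≤ (‖T†Tx‖‖x‖)²  and  ‖x‖²·(goal) ⇐ (‖x‖² − ‖Tx‖²)² ≥ 0
  have h2 : (‖T x‖ ^ 2) ^ 2 ≤ (‖ContinuousLinearMap.adjoint T (T x)‖ * ‖x‖) ^ 2 :=
    pow_le_pow_left₀ (sq_nonneg _) h1 2
  nlinarith [sq_nonneg (‖x‖ ^ 2 - ‖T x‖ ^ 2), mul_pos hn hn, h2, sq_nonneg ‖ContinuousLinearMap.adjoint T (T x)‖,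
    mul_nonneg ha hn.le]

/-- **Forward-loss comparability.**  The T-form loss-currency clause gives `q_U(x) ≤ (1 + 2η)·q_T(x)`. -/
theorem loss_le_of_lossBound {U T : H →L[ℝ] H} {η : ℝ} (hη : 0 ≤ η) (hT : ∀ y, ‖T y‖ ≤ ‖y‖)
    (h : ∀ x ζ : H, |⟪U x - T x, ζ⟫_ℝ|
      ≤ η * Real.sqrt (‖x‖ ^ 2 - ‖T x‖ ^ 2) * Real.sqrt (‖ζ‖ ^ 2 - ‖ContinuousLinearMap.adjoint T ζ‖ ^ 2))
    (x : H) : ‖x‖ ^ 2 - ‖U x‖ ^ 2 ≤ (1 + 2 * η) * (‖x‖ ^ 2 - ‖T x‖ ^ 2) := by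
  set qT : ℝ := ‖x‖ ^ 2 - ‖T x‖ ^ 2 with hqT
  have hqT0 : 0 ≤ qT := loss_nonneg hT x
  -- expand ‖Ux‖² = ‖Tx‖² + 2⟪Ux − Tx, Tx⟫ + ‖Ux − Tx‖²
  have hexp : ‖U x‖ ^ 2 = ‖T x‖ ^ 2 + 2 * ⟪U x - T x, T x⟫_ℝ + ‖U x - T x‖ ^ 2 := by
    have e : U x = T x + (U x - T x) := by abel
    rw [e, norm_add_sq_real, real_inner_comm]
    simp
  -- the clause tested with ζ := Tx, and q*_T(Tx) ≤ q_T(x)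
  have hc := h x (T x)
  have hstar : Real.sqrt (‖T x‖ ^ 2 - ‖ContinuousLinearMap.adjoint T (T x)‖ ^ 2) ≤ Real.sqrt qT :=
    Real.sqrt_le_sqrt (lossAdj_apply_le_loss hT x)
  have hin : |⟪U x - T x, T x⟫_ℝ| ≤ η * qT := by
    calc |⟪U x - T x, T x⟫_ℝ|
        ≤ η * Real.sqrt qT * Real.sqrt (‖T x‖ ^ 2 - ‖ContinuousLinearMap.adjoint T (T x)‖ ^ 2) := hc
      _ ≤ η * Real.sqrt qT * Real.sqrt qT := by gcongr
      _ = η * qT := by rw [mul_assoc, Real.mul_self_sqrt hqT0]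
  have hlow : -(η * qT) ≤ ⟪U x - T x, T x⟫_ℝ := by
    have := neg_abs_le (⟪U x - T x, T x⟫_ℝ); linarith
  have hsq : 0 ≤ ‖U x - T x‖ ^ 2 := sq_nonneg _
  rw [hexp]
  nlinarith

/-- **Adjoint-loss comparability** (the dual statement): `q*_U(ζ) ≤ (1 + 2η)·q*_T(ζ)`. -/
theorem lossAdj_le_of_lossBound {U T : H →L[ℝ] H} {η : ℝ} (hη : 0 ≤ η) (hT : ∀ y, ‖T y‖ ≤ ‖y‖)
    (h : ∀ x ζ : H, |⟪U x - T x, ζ⟫_ℝ|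
      ≤ η * Real.sqrt (‖x‖ ^ 2 - ‖T x‖ ^ 2) * Real.sqrt (‖ζ‖ ^ 2 - ‖ContinuousLinearMap.adjoint T ζ‖ ^ 2))
    (ζ : H) : ‖ζ‖ ^ 2 - ‖ContinuousLinearMap.adjoint U ζ‖ ^ 2
      ≤ (1 + 2 * η) * (‖ζ‖ ^ 2 - ‖ContinuousLinearMap.adjoint T ζ‖ ^ 2) := by
  -- apply the forward lemma to the adjoint pair (U†, T†): the clause is self-dual
  have hT' : ∀ y, ‖ContinuousLinearMap.adjoint T y‖ ≤ ‖y‖ := norm_adjoint_le hT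
  have h' : ∀ x' ζ' : H, |⟪ContinuousLinearMap.adjoint U x' - ContinuousLinearMap.adjoint T x', ζ'⟫_ℝ|
      ≤ η * Real.sqrt (‖x'‖ ^ 2 - ‖ContinuousLinearMap.adjoint T x'‖ ^ 2)
        * Real.sqrt (‖ζ'‖ ^ 2 - ‖ContinuousLinearMap.adjoint (ContinuousLinearMap.adjoint T) ζ'‖ ^ 2) := by
    intro x' ζ'
    have e : ⟪ContinuousLinearMap.adjoint U x' - ContinuousLinearMap.adjoint T x', ζ'⟫_ℝ = ⟪U ζ' - T ζ', x'⟫_ℝ := by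
      rw [inner_sub_left, inner_sub_left, ContinuousLinearMap.adjoint_inner_left, ContinuousLinearMap.adjoint_inner_left,
        real_inner_comm (U ζ'), real_inner_comm (T ζ')]
    rw [e, ContinuousLinearMap.adjoint_adjoint]
    calc |⟪U ζ' - T ζ', x'⟫_ℝ|
        ≤ η * Real.sqrt (‖ζ'‖ ^ 2 - ‖T ζ'‖ ^ 2) * Real.sqrt (‖x'‖ ^ 2 - ‖ContinuousLinearMap.adjoint T x'‖ ^ 2) := h ζ' x'
      _ = η * Real.sqrt (‖x'‖ ^ 2 - ‖ContinuousLinearMap.adjoint T x'‖ ^ 2) * Real.sqrt (‖ζ'‖ ^ 2 - ‖T ζ'‖ ^ 2) := by ring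
  have := loss_le_of_lossBound hη hT' h' ζ
  simpa [ContinuousLinearMap.adjoint_adjoint] using this

/-- Packaged: under the T-form clause the MIXED-form constant is at most `η·√(1+2η)`:
`|⟪(U−T)x, ζ⟫| ≤ η√q_T(x)√q*_T(ζ)` and `q_T ≤ q_T` trivially, while conversely a mixed bound with `q_U` in place of `q_T` loses at most
the factor `√(1+2η)` — recorded as the inequality `√q_U(x) ≤ √(1+2η)·√q_T(x)`. -/
theorem sqrt_loss_le_of_lossBound {U T : H →L[ℝ] H} {η : ℝ} (hη : 0 ≤ η) (hT : ∀ y, ‖T y‖ ≤ ‖y‖)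
    (h : ∀ x ζ : H, |⟪U x - T x, ζ⟫_ℝ|
      ≤ η * Real.sqrt (‖x‖ ^ 2 - ‖T x‖ ^ 2) * Real.sqrt (‖ζ‖ ^ 2 - ‖ContinuousLinearMap.adjoint T ζ‖ ^ 2))
    (x : H) : Real.sqrt (‖x‖ ^ 2 - ‖U x‖ ^ 2) ≤ Real.sqrt (1 + 2 * η) * Real.sqrt (‖x‖ ^ 2 - ‖T x‖ ^ 2) := by
  rw [← Real.sqrt_mul (by linarith)]
  exact Real.sqrt_le_sqrt (loss_le_of_lossBound hη hT h x)

/-! ## Asymmetric composition (short post-refresh sub-window) — amendment 1 (lead-k1l-onelevel-p1 g5: p5 g14 companion v2 27361c272899, §"Asymmetric composition" VERBATIM; ruling D26-13′ (3))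

The landed `LossCurrency.lossBound_comp` replaces the second window's own adjoint loss `q*_{T₂}(ζ)` and the first window's own forward
loss `q_{T₁}(x)` by the composite losses.  For the glue's PARTIAL second sub-window `[(j+1)τ_r, s′]` (arbitrarily short) this loses the
compensation `η₂(τ₂)·√q*_{T₂}(ζ) → 0` (`η₂ ∝ (P/τ₂)^σ`, `q*_{T₂}(ζ) ∝ τ₂`, `σ < 1/2`).  The variant below keeps both OUTER losses:
`|⟪(U₂U₁ − T₂T₁)x, ζ⟫| ≤ η₂√(2+2η₁²)·√q_{T₂T₁}(x)·√q*_{T₂}(ζ) + η₁·√q_{T₁}(x)·√q*_{T₂T₁}(ζ)` — same proof as the landed one, one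
monotonicity step fewer on each term. -/
/-- **ASYMMETRIC composition**: `|⟪(U₂U₁ − T₂T₁)x, ζ⟫| ≤ η₂√(2+2η₁²)·√q_{T₂T₁}(x)·√q*_{T₂}(ζ) + η₁·√q_{T₁}(x)·√q*_{T₂T₁}(ζ)` — the second
window keeps its OWN adjoint loss and the first window its own forward loss (see the section docstring). -/
theorem lossBound_comp_asym {U₁ T₁ U₂ T₂ : H →L[ℝ] H} {η₁ η₂ : ℝ} (hη₁ : 0 ≤ η₁) (hη₂ : 0 ≤ η₂)
    (hT₁ : ∀ y, ‖T₁ y‖ ≤ ‖y‖) (hT₂ : ∀ y, ‖T₂ y‖ ≤ ‖y‖)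
    (h₁ : ∀ x ζ : H, |⟪U₁ x - T₁ x, ζ⟫_ℝ| ≤ η₁ * Real.sqrt (‖x‖ ^ 2 - ‖T₁ x‖ ^ 2) * Real.sqrt (‖ζ‖ ^ 2 - ‖ContinuousLinearMap.adjoint T₁ ζ‖ ^ 2))
    (h₂ : ∀ x ζ : H, |⟪U₂ x - T₂ x, ζ⟫_ℝ| ≤ η₂ * Real.sqrt (‖x‖ ^ 2 - ‖T₂ x‖ ^ 2) * Real.sqrt (‖ζ‖ ^ 2 - ‖ContinuousLinearMap.adjoint T₂ ζ‖ ^ 2))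
    (x ζ : H) :
    |⟪U₂ (U₁ x) - T₂ (T₁ x), ζ⟫_ℝ|
      ≤ η₂ * Real.sqrt (2 + 2 * η₁ ^ 2) * Real.sqrt (‖x‖ ^ 2 - ‖(T₂.comp T₁) x‖ ^ 2)
          * Real.sqrt (‖ζ‖ ^ 2 - ‖ContinuousLinearMap.adjoint T₂ ζ‖ ^ 2)
        + η₁ * Real.sqrt (‖x‖ ^ 2 - ‖T₁ x‖ ^ 2)
          * Real.sqrt (‖ζ‖ ^ 2 - ‖ContinuousLinearMap.adjoint (T₂.comp T₁) ζ‖ ^ 2) := by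
  set Q : ℝ := ‖x‖ ^ 2 - ‖(T₂.comp T₁) x‖ ^ 2 with hQ
  set Qs : ℝ := ‖ζ‖ ^ 2 - ‖ContinuousLinearMap.adjoint (T₂.comp T₁) ζ‖ ^ 2 with hQs
  have hsplit : U₂ (U₁ x) - T₂ (T₁ x) = (U₂ (U₁ x) - T₂ (U₁ x)) + T₂ (U₁ x - T₁ x) := by rw [map_sub]; abel
  -- first term: `(U₂ − T₂)(U₁ x)` against `ζ`, keeping `q*_{T₂}(ζ)`
  have hδ₁ : ‖U₁ x - T₁ x‖ ≤ η₁ * Real.sqrt (‖x‖ ^ 2 - ‖T₁ x‖ ^ 2) := norm_sub_le_of_lossBound hη₁ x (h₁ x)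
  have hq2 : ‖U₁ x‖ ^ 2 - ‖T₂ (U₁ x)‖ ^ 2 ≤ (2 + 2 * η₁ ^ 2) * Q := by
    have e : U₁ x = T₁ x + (U₁ x - T₁ x) := by abel
    have h1 := loss_add_le hT₂ (T₁ x) (U₁ x - T₁ x)
    rw [← e] at h1
    have h2 : ‖T₁ x‖ ^ 2 - ‖T₂ (T₁ x)‖ ^ 2 ≤ Q := loss_apply_le_loss_comp hT₁ x
    have h3 : ‖U₁ x - T₁ x‖ ^ 2 - ‖T₂ (U₁ x - T₁ x)‖ ^ 2 ≤ ‖U₁ x - T₁ x‖ ^ 2 := by nlinarith [norm_nonneg (T₂ (U₁ x - T₁ x))]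
    have h4 : ‖U₁ x - T₁ x‖ ^ 2 ≤ η₁ ^ 2 * (‖x‖ ^ 2 - ‖T₁ x‖ ^ 2) := by
      have h0 : 0 ≤ ‖x‖ ^ 2 - ‖T₁ x‖ ^ 2 := loss_nonneg hT₁ x
      calc ‖U₁ x - T₁ x‖ ^ 2 ≤ (η₁ * Real.sqrt (‖x‖ ^ 2 - ‖T₁ x‖ ^ 2)) ^ 2 := pow_le_pow_left₀ (norm_nonneg _) hδ₁ 2
        _ = η₁ ^ 2 * (‖x‖ ^ 2 - ‖T₁ x‖ ^ 2) := by rw [mul_pow, Real.sq_sqrt h0]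
    have h5 : ‖x‖ ^ 2 - ‖T₁ x‖ ^ 2 ≤ Q := loss_le_loss_comp hT₂ x
    nlinarith [sq_nonneg η₁]
  have hA := h₂ (U₁ x) ζ
  have hA' : |⟪U₂ (U₁ x) - T₂ (U₁ x), ζ⟫_ℝ| ≤ η₂ * Real.sqrt ((2 + 2 * η₁ ^ 2) * Q)
      * Real.sqrt (‖ζ‖ ^ 2 - ‖ContinuousLinearMap.adjoint T₂ ζ‖ ^ 2) := by
    refine hA.trans ?_
    gcongr
  -- second term: `(U₁ − T₁)x` against `T₂† ζ`, keeping `q_{T₁}(x)`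
  have hB := h₁ x (ContinuousLinearMap.adjoint T₂ ζ)
  have hB0 : ⟪T₂ (U₁ x - T₁ x), ζ⟫_ℝ = ⟪U₁ x - T₁ x, ContinuousLinearMap.adjoint T₂ ζ⟫_ℝ := by
    rw [ContinuousLinearMap.adjoint_inner_right]
  have hqs1 : ‖ContinuousLinearMap.adjoint T₂ ζ‖ ^ 2 - ‖ContinuousLinearMap.adjoint T₁ (ContinuousLinearMap.adjoint T₂ ζ)‖ ^ 2 ≤ Qs :=
    lossAdj_adjoint_le_lossAdj_comp hT₂ ζ
  have hB' : |⟪T₂ (U₁ x - T₁ x), ζ⟫_ℝ| ≤ η₁ * Real.sqrt (‖x‖ ^ 2 - ‖T₁ x‖ ^ 2) * Real.sqrt Qs := by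
    rw [hB0]
    refine hB.trans ?_
    gcongr
  have htri : |⟪U₂ (U₁ x) - T₂ (T₁ x), ζ⟫_ℝ| ≤ |⟪U₂ (U₁ x) - T₂ (U₁ x), ζ⟫_ℝ| + |⟪T₂ (U₁ x - T₁ x), ζ⟫_ℝ| := by
    rw [hsplit, inner_add_left]
    exact abs_add_le _ _
  have hsq : Real.sqrt ((2 + 2 * η₁ ^ 2) * Q) = Real.sqrt (2 + 2 * η₁ ^ 2) * Real.sqrt Q := Real.sqrt_mul (by positivity) Q
  rw [hsq, ← mul_assoc] at hA'
  exact htri.trans (add_le_add hA' hB')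

/-- **RAW composition** (no monotonicity step at all): each factor keeps the loss of ITS OWN window —
`|⟪(U₂U₁ − T₂T₁)x, ζ⟫| ≤ η₂·√(2·q_{T₂}(T₁x) + 2η₁²·q_{T₁}(x))·√q*_{T₂}(ζ) + η₁·√q_{T₁}(x)·√q*_{T₁}(T₂†ζ)`.
For the glue's short second sub-window both `q_{T₂}(T₁x)` (slow data barely decays in `τ₂`) and `q*_{T₂}(ζ)` are `∝ τ₂`, which is what
compensates the large short-window constant `η₂(τ₂)`; `lossBound_comp` / `lossBound_comp_asym` follow by monotonicity. -/
theorem lossBound_comp_raw {U₁ T₁ U₂ T₂ : H →L[ℝ] H} {η₁ η₂ : ℝ} (hη₁ : 0 ≤ η₁) (hη₂ : 0 ≤ η₂)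
    (hT₁ : ∀ y, ‖T₁ y‖ ≤ ‖y‖) (hT₂ : ∀ y, ‖T₂ y‖ ≤ ‖y‖)
    (h₁ : ∀ x ζ : H, |⟪U₁ x - T₁ x, ζ⟫_ℝ| ≤ η₁ * Real.sqrt (‖x‖ ^ 2 - ‖T₁ x‖ ^ 2) * Real.sqrt (‖ζ‖ ^ 2 - ‖ContinuousLinearMap.adjoint T₁ ζ‖ ^ 2))
    (h₂ : ∀ x ζ : H, |⟪U₂ x - T₂ x, ζ⟫_ℝ| ≤ η₂ * Real.sqrt (‖x‖ ^ 2 - ‖T₂ x‖ ^ 2) * Real.sqrt (‖ζ‖ ^ 2 - ‖ContinuousLinearMap.adjoint T₂ ζ‖ ^ 2))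
    (x ζ : H) :
    |⟪U₂ (U₁ x) - T₂ (T₁ x), ζ⟫_ℝ|
      ≤ η₂ * Real.sqrt (2 * (‖T₁ x‖ ^ 2 - ‖T₂ (T₁ x)‖ ^ 2) + 2 * η₁ ^ 2 * (‖x‖ ^ 2 - ‖T₁ x‖ ^ 2))
          * Real.sqrt (‖ζ‖ ^ 2 - ‖ContinuousLinearMap.adjoint T₂ ζ‖ ^ 2)
        + η₁ * Real.sqrt (‖x‖ ^ 2 - ‖T₁ x‖ ^ 2)
          * Real.sqrt (‖ContinuousLinearMap.adjoint T₂ ζ‖ ^ 2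
              - ‖ContinuousLinearMap.adjoint T₁ (ContinuousLinearMap.adjoint T₂ ζ)‖ ^ 2) := by
  have hsplit : U₂ (U₁ x) - T₂ (T₁ x) = (U₂ (U₁ x) - T₂ (U₁ x)) + T₂ (U₁ x - T₁ x) := by rw [map_sub]; abel
  -- first term: `(U₂ − T₂)(U₁ x)` against `ζ`; `q_{T₂}(U₁x) ≤ 2 q_{T₂}(T₁x) + 2‖(U₁−T₁)x‖² ≤ 2 q_{T₂}(T₁x) + 2η₁² q_{T₁}(x)`
  have hδ₁ : ‖U₁ x - T₁ x‖ ≤ η₁ * Real.sqrt (‖x‖ ^ 2 - ‖T₁ x‖ ^ 2) := norm_sub_le_of_lossBound hη₁ x (h₁ x)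
  have hq2 : ‖U₁ x‖ ^ 2 - ‖T₂ (U₁ x)‖ ^ 2 ≤ 2 * (‖T₁ x‖ ^ 2 - ‖T₂ (T₁ x)‖ ^ 2) + 2 * η₁ ^ 2 * (‖x‖ ^ 2 - ‖T₁ x‖ ^ 2) := by
    have e : U₁ x = T₁ x + (U₁ x - T₁ x) := by abel
    have h1 := loss_add_le hT₂ (T₁ x) (U₁ x - T₁ x)
    rw [← e] at h1
    have h3 : ‖U₁ x - T₁ x‖ ^ 2 - ‖T₂ (U₁ x - T₁ x)‖ ^ 2 ≤ ‖U₁ x - T₁ x‖ ^ 2 := by nlinarith [norm_nonneg (T₂ (U₁ x - T₁ x))]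
    have h4 : ‖U₁ x - T₁ x‖ ^ 2 ≤ η₁ ^ 2 * (‖x‖ ^ 2 - ‖T₁ x‖ ^ 2) := by
      have h0 : 0 ≤ ‖x‖ ^ 2 - ‖T₁ x‖ ^ 2 := loss_nonneg hT₁ x
      calc ‖U₁ x - T₁ x‖ ^ 2 ≤ (η₁ * Real.sqrt (‖x‖ ^ 2 - ‖T₁ x‖ ^ 2)) ^ 2 := pow_le_pow_left₀ (norm_nonneg _) hδ₁ 2
        _ = η₁ ^ 2 * (‖x‖ ^ 2 - ‖T₁ x‖ ^ 2) := by rw [mul_pow, Real.sq_sqrt h0]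
    nlinarith
  have hA := h₂ (U₁ x) ζ
  have hA' : |⟪U₂ (U₁ x) - T₂ (U₁ x), ζ⟫_ℝ|
      ≤ η₂ * Real.sqrt (2 * (‖T₁ x‖ ^ 2 - ‖T₂ (T₁ x)‖ ^ 2) + 2 * η₁ ^ 2 * (‖x‖ ^ 2 - ‖T₁ x‖ ^ 2))
        * Real.sqrt (‖ζ‖ ^ 2 - ‖ContinuousLinearMap.adjoint T₂ ζ‖ ^ 2) := by
    refine hA.trans ?_
    gcongr
  -- second term: `(U₁ − T₁)x` against `T₂† ζ`, verbatim
  have hB := h₁ x (ContinuousLinearMap.adjoint T₂ ζ)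
  have hB0 : ⟪T₂ (U₁ x - T₁ x), ζ⟫_ℝ = ⟪U₁ x - T₁ x, ContinuousLinearMap.adjoint T₂ ζ⟫_ℝ := by
    rw [ContinuousLinearMap.adjoint_inner_right]
  have htri : |⟪U₂ (U₁ x) - T₂ (T₁ x), ζ⟫_ℝ| ≤ |⟪U₂ (U₁ x) - T₂ (U₁ x), ζ⟫_ℝ| + |⟪T₂ (U₁ x - T₁ x), ζ⟫_ℝ| := by
    rw [hsplit, inner_add_left]
    exact abs_add_le _ _
  rw [hB0] at htri
  exact htri.trans (add_le_add hA' hB)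

end Summit.AnomalousDissipation.AnomalousDissipation.Theorems.SolenoidalFractalHomogenisation.LagrangianStep.LossCurrency

end
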